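import Literature.Geometry.Manifold.OpenSubmanifoldTangent
import Literature.Geometry.Lorentzian.PseudoRiemannianMetric
import Mathlib.Analysis.Normed.Module.FiniteDimension
import Mathlib.Analysis.Normed.Operator.Bilinear
import HarnessLib

/-!
# Positive definiteness of a field of bilinear forms is an open condition

Topic `Literature/Geometry/Manifold` (namespace `Literature.Geometry.Manifold`). Two elementary
facts used when a Riemannian metric is produced by EXTENDING a positive definite field of
bilinear forms beyond the set where it is given (e.g. a metric of a compact piece `M ⊂ P`
extended to an open neighbourhood in the glued manifold `P`, layer L1 of the proof programme of
`Literature.Geometry.Riemannian.BaerHankePscGluing`; Bär–Hanke 2023, §3: the normal exponential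
map of a manifold with boundary is taken inside an open manifold carrying an extension of the
metric): the extension is automatically positive definite NEAR that set.

* `isOpen_setOf_posDef` — on a finite-dimensional real normed space `E`, the positive definite
  continuous bilinear forms form an open subset of `E →L[ℝ] E →L[ℝ] ℝ` (the minimum of
  `v ↦ B₀ v v` on the unit sphere is positive and `|B v v − B₀ v v| ≤ ‖B − B₀‖ ‖v‖²`);
* `isOpen_setOf_posDef_section` — for a `C^n` field `s` of continuous bilinear forms on the
  tangent spaces of a manifold `X` (a `C^n` section of `Hom(TX, Hom(TX, ℝ))`, the smoothness
  notion of `Bundle.ContMDiffRiemannianMetric` / `PseudoRiemannianMetric`), the set of points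
  where `s_x` is positive definite is open in `X` (read `s` in the trivialisation at `x₀`:
  `ContMDiffAt` of the trivialised expression, `contMDiffAt_hom_bundle`, and the fibrewise
  linear isomorphisms of the trivialisation);
* `exists_riemannianMetric_opens_of_posDefOn` — consequently a `C^n` SYMMETRIC field of bilinear
  forms which is positive definite on a set `K` restricts to a Riemannian `PseudoRiemannianMetric`
  on an open submanifold `W ⊇ K` (the positivity locus; restriction of smooth sections to open
  submanifolds, `OpenSubmanifold.contMDiff_bilinSection`).

Everything is proved; no definitions and no named facts are introduced.

## References

* S. Lang, *Fundamentals of Differential Geometry*, GTM 191 (1999), Ch. VII §1 (Riemannian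
  metrics: positive definiteness is an open condition on the fibres; partitions of unity). [folklore]
* C. Bär, B. Hanke, *Boundary conditions for scalar curvature*, arXiv:2012.09127, §3 (the
  boundary collar via the normal exponential map). [BarHanke2023]
-/

noncomputable section

open Bundle Set Filter Function TopologicalSpace Metric
open scoped Manifold ContDiff Topology

namespace Literature.Geometry.Manifold

/-! ### Linear algebra: positive definite forms are an open set -/

/-- **Positive definiteness is an open condition** on the continuous bilinear forms of a
finite-dimensional real normed space: if `B₀ v v > 0` for all `v ≠ 0` then the same holds for
every `B` with `‖B − B₀‖ < m/2`, `m > 0` the minimum of `v ↦ B₀ v v` on the unit sphere, since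
`B v v ≥ B₀ v v − ‖B − B₀‖ ‖v‖² ≥ (m − m/2) ‖v‖²`. [folklore] -/
theorem isOpen_setOf_posDef {E : Type*} [NormedAddCommGroup E] [NormedSpace ℝ E]
    [FiniteDimensional ℝ E] :
    IsOpen {B : E →L[ℝ] E →L[ℝ] ℝ | ∀ v : E, v ≠ 0 → 0 < B v v} := by
  refine (Metric.isOpen_iff (α := E →L[ℝ] E →L[ℝ] ℝ)).2 fun B₀ hB₀ ↦ ?_
  by_cases hE : Subsingleton E
  · exact ⟨1, one_pos, fun B _ v hv ↦ absurd (Subsingleton.elim v 0) hv⟩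
  rw [not_subsingleton_iff_nontrivial] at hE
  -- the minimum of `v ↦ B₀ v v` on the unit sphere
  have hS : IsCompact (sphere (0 : E) 1) := isCompact_sphere 0 1
  have hne : (sphere (0 : E) 1).Nonempty := NormedSpace.sphere_nonempty.2 zero_le_one
  have hcont : Continuous fun v : E ↦ B₀ v v := B₀.continuous.clm_apply continuous_id
  obtain ⟨u, hu, hmin⟩ := hS.exists_isMinOn hne hcont.continuousOn
  have hu0 : u ≠ 0 := by
    intro h
    simp [h] at hu
  set m := B₀ u u with hm
  have hmpos : 0 < m := hB₀ u hu0
  refine ⟨m / 2, by positivity, fun B hB v hv ↦ ?_⟩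
  have hB' : ‖B - B₀‖ < m / 2 := lt_of_eq_of_lt (dist_eq_norm B B₀).symm hB
  have hnv : 0 < ‖v‖ := norm_pos_iff.2 hv
  -- rescale `v` to the unit sphere
  set w := ‖v‖⁻¹ • v with hw
  have hwS : w ∈ sphere (0 : E) 1 := by
    simp [hw, norm_smul, hnv.ne']
  have h1 : m ≤ B₀ w w := hmin hwS
  have h2 : |(B - B₀) w w| ≤ ‖B - B₀‖ := by
    have := (B - B₀).le_opNorm₂ w w
    rw [mem_sphere_zero_iff_norm.1 hwS, mul_one, mul_one] at this
    exact (Real.norm_eq_abs _ ▸ this)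
  have h3 : 0 < B w w := by
    have h4 : (B - B₀) w w = B w w - B₀ w w := by simp
    have h5 := (abs_le.mp h2).1
    rw [h4] at h5
    linarith [hB']
  have h6 : B v v = ‖v‖ ^ 2 * B w w := by
    have hv' : v = ‖v‖ • w := by
      rw [hw, smul_smul, mul_inv_cancel₀ hnv.ne', one_smul]
    conv_lhs => rw [hv']
    simp only [map_smul, FunLike.coe_smul, Pi.smul_apply, smul_eq_mul]
    ring
  rw [h6]
  positivity

/-! ### Manifolds: the positivity locus of a smooth field of bilinear forms is open -/

variable {E : Type*} [NormedAddCommGroup E] [NormedSpace ℝ E] [FiniteDimensional ℝ E]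
  {H : Type*} [TopologicalSpace H] {I : ModelWithCorners ℝ E H}
  {X : Type*} [TopologicalSpace X] [ChartedSpace H X] [IsManifold I ∞ X]

/-- **The set where a `C^n` field of bilinear forms on the tangent spaces is positive definite is
open.** For a `C^n` section `s` of `Hom(TX, Hom(TX, ℝ))` (any `n`; only continuity is used) the
set `{x | ∀ v ≠ 0, 0 < s_x(v, v)}` is open in `X`: near `x₀` the trivialised expression
`x ↦ (v, w) ↦ s_x(e⁻¹ₓ v, e⁻¹ₓ w)` (`e` the trivialisation of `TX` at `x₀`, a linear isomorphism
on each fibre over the chart domain) is continuous at `x₀` with values in the open set of positive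
definite forms on the model space (`isOpen_setOf_posDef`). In particular a field of bilinear forms
which is positive definite on a set `K` is positive definite on an open neighbourhood of `K`
(used to extend Riemannian metrics: Lang 1999, Ch. VII §1). [folklore] -/
theorem isOpen_setOf_posDef_section {n : ℕ∞ω}
    {s : Π x : X, TangentSpace I x →L[ℝ] TangentSpace I x →L[ℝ] ℝ}
    (hs : ContMDiff I (I.prod 𝓘(ℝ, E →L[ℝ] E →L[ℝ] ℝ)) n
      (fun x : X ↦ TotalSpace.mk' (E →L[ℝ] E →L[ℝ] ℝ)
        (E := fun y : X ↦ TangentSpace I y →L[ℝ] TangentSpace I y →L[ℝ] ℝ) x (s x))) :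
    IsOpen {x : X | ∀ v : TangentSpace I x, v ≠ 0 → 0 < s x v v} := by
  rw [isOpen_iff_mem_nhds]
  intro x₀ hx₀
  -- the trivialised expression of `s` at `x₀`
  set eT := trivializationAt E (TangentSpace I : X → Type _) x₀ with heT
  set F : X → E →L[ℝ] E →L[ℝ] ℝ := fun x ↦
    ContinuousLinearMap.inCoordinates E (TangentSpace I : X → Type _) (E →L[ℝ] ℝ)
      (fun y : X ↦ TangentSpace I y →L[ℝ] ℝ) x₀ x x₀ x (s x) with hF
  have hFc : ContinuousAt F x₀ := by
    have h := ((contMDiffAt_hom_bundle _).1 (hs x₀)).2.continuousAt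
    exact h
  -- on the chart domain of `x₀`, `F x v w = s x (e⁻¹ v) (e⁻¹ w)`
  have hnhds : ∀ᶠ x in 𝓝 x₀, x ∈ (chartAt H x₀).source :=
    (chartAt H x₀).open_source.mem_nhds (mem_chart_source H x₀)
  have hFapply : ∀ x, x ∈ (chartAt H x₀).source → ∀ v w : E,
      F x v w = s x (eT.symm x v) (eT.symm x w) := by
    intro x hx v w
    have hxX : x ∈ eT.baseSet := by
      simpa only [heT, TangentBundle.trivializationAt_baseSet] using hx
    rw [hF]
    dsimp only
    rw [inCoordinates_apply_eq₂ hxX hxX (Set.mem_univ _)]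
    simp only [Trivial.fiberBundle_trivializationAt', Trivial.linearMapAt_trivialization,
      LinearMap.id_coe, id_eq]
    rfl
  -- positive definiteness of `s x` versus `F x` on the chart domain
  have hiff : ∀ x, x ∈ (chartAt H x₀).source →
      ((∀ v : E, v ≠ 0 → 0 < F x v v) ↔ ∀ v : TangentSpace I x, v ≠ 0 → 0 < s x v v) := by
    intro x hx
    have hxX : x ∈ eT.baseSet := by
      simpa only [heT, TangentBundle.trivializationAt_baseSet] using hx
    set L := eT.continuousLinearEquivAt ℝ x hxX with hL
    have hsymm : ∀ v : E, eT.symm x v = L.symm v := fun v ↦ by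
      rw [hL, ← Trivialization.symmL_apply (R := ℝ) eT hxX v,
        ← Trivialization.symm_continuousLinearEquivAt_eq eT hxX]
    constructor
    · intro h w hw
      have hv : L w ≠ 0 := fun h0 ↦ hw (by simpa using congrArg L.symm h0)
      have := h (L w) hv
      rwa [hFapply x hx, hsymm, L.symm_apply_apply] at this
    · intro h v hv
      have hw : L.symm v ≠ 0 := fun h0 ↦ hv (by simpa using congrArg L h0)
      rw [hFapply x hx, hsymm]
      exact h _ hw
  -- conclude: the positivity locus contains the neighbourhood `F ⁻¹' PosDef ∩ chart source`
  have hF0 : F x₀ ∈ {B : E →L[ℝ] E →L[ℝ] ℝ | ∀ v : E, v ≠ 0 → 0 < B v v} :=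
    (hiff x₀ (mem_chart_source H x₀)).2 hx₀
  have hpre : ∀ᶠ x in 𝓝 x₀, F x ∈ {B : E →L[ℝ] E →L[ℝ] ℝ | ∀ v : E, v ≠ 0 → 0 < B v v} :=
    hFc.preimage_mem_nhds (isOpen_setOf_posDef.mem_nhds hF0)
  filter_upwards [hpre, hnhds] with x hx hx'
  exact (hiff x hx').1 hx

/-! ### A positive definite extension is a Riemannian metric near the set -/

open Literature.Geometry.Lorentzian in
/-- **A symmetric field of bilinear forms, positive definite on `K`, is a Riemannian metric on an
open submanifold containing `K`.** For a `C^n` section `s` of `Hom(TX, Hom(TX, ℝ))` which is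
symmetric everywhere and positive definite at the points of `K ⊆ X`, the positivity locus
`W = {x | s_x > 0}` is an open submanifold containing `K` (`isOpen_setOf_posDef_section`) on which
`s` restricts to a `C^n` pseudo-Riemannian metric (`OpenSubmanifold.contMDiff_bilinSection`;
nondegeneracy from positivity) which is Riemannian and equal to `s` pointwise. This is how an
extension of the metric of a piece `M ⊂ P` to a neighbourhood becomes a Riemannian metric on a
smaller neighbourhood (Lang 1999, Ch. VII §1; layer L1 of `BaerHankePscGluing`). [folklore] -/
theorem exists_riemannianMetric_opens_of_posDefOn {n : ℕ∞ω}
    {s : Π x : X, TangentSpace I x →L[ℝ] TangentSpace I x →L[ℝ] ℝ}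
    (hs : ContMDiff I (I.prod 𝓘(ℝ, E →L[ℝ] E →L[ℝ] ℝ)) n
      (fun x : X ↦ TotalSpace.mk' (E →L[ℝ] E →L[ℝ] ℝ)
        (E := fun y : X ↦ TangentSpace I y →L[ℝ] TangentSpace I y →L[ℝ] ℝ) x (s x)))
    (hsymm : ∀ (x : X) (v w : TangentSpace I x), s x v w = s x w v) {K : Set X}
    (hK : ∀ x ∈ K, ∀ v : TangentSpace I x, v ≠ 0 → 0 < s x v v) :
    ∃ W : Opens X, K ⊆ (W : Set X) ∧
      ∃ gW : PseudoRiemannianMetric I n E (TangentSpace I : W → Type _),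
        gW.IsRiemannian ∧ ∀ (x : W) (v w : TangentSpace I x), gW.val x v w = s x.1 v w := by
  set W : Opens X := ⟨{x : X | ∀ v : TangentSpace I x, v ≠ 0 → 0 < s x v v},
    isOpen_setOf_posDef_section hs⟩ with hW
  have hKW : K ⊆ (W : Set X) := fun x hx ↦ hK x hx
  refine ⟨W, hKW, ?_⟩
  refine ⟨⟨fun x : W ↦ s x.1, fun x v w ↦ hsymm x.1 v w, fun x v hv ↦ ?_,
    OpenSubmanifold.contMDiff_bilinSection hs W⟩, fun x v hv ↦ x.2 v hv, fun x v w ↦ rfl⟩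
  -- positivity forces nondegeneracy
  by_contra h
  exact (lt_irrefl (0 : ℝ)) ((x.2 v h).trans_eq (hv v))

end Literature.Geometry.Manifold

end
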